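import Summits.HodgeConjecture.CorCM.AndreSplitWeilType
import Literature.AlgebraicGeometry.Deligne1982.WeilTypeCMDiscriminant
import HarnessLib

/-!
# COR-CM (cell `pub-hodgecm2`), André 1992 in Milne's SPLIT form (1/3): Deligne's presentation `E = ℚ[T]/(R(T²))`
# at a purely imaginary separating integer, and WEIL TYPE of André's constant-sum products for `η = act(b₀)` itself

Literature seat `lit-milne` (gen 56), count-neutral for the binder table; THEOREMS ONLY (no definition, no named
fact, D-0026). First of three files (`AndreSplitWeilTypeGenerator` → `AndreSplitWeilTypeTwist` → `AndreSplitFormHolds`)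
discharging the Literature named fact `HodgeTheory.Andre1992_hodgeClasses_cmType_mem_span_pullback_splitWeilClassesCM`
(André 1992 = Milne 2020 Thm. 1 with its proof, faithful SPLIT form). HONEST FRAMING: structure statements only; no case of
the Hodge conjecture is proved, `HC_CM` does not occur in this file.

* §1 `exists_imaginary_separating`, `exists_sq_eq_minpoly` — for a (Galois) CM field `K`: a purely imaginary
  `b₀ ∈ 𝓞_K` separating the complex embeddings, and Deligne's presentation `minpoly_ℤ(b₀) = R(T²)`, `R ∈ ℤ[S]` monic of
  degree `e₀ = [K:ℚ]/2` with real negative roots, `P_R = R(T²)` irreducible, a Galois CM field polynomial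
  (Deligne §4 p. 30: «`E = ℚ(η)` … `η̄ = -η` … `F = ℚ(η²)` totally real»; the cell's `Milne2020.isGaloisCMFieldPoly_minpoly`,
  Literature `Deligne1982.exists_even_minpoly`). Fixing `b₀` ONCE makes `R`, `e₀` uniform over all targets `A_Δ` and all `p`.
* §2 `isWeilTypeCM_diagHom` — for realisations `(B_j, Ψ_j)`, `j < 2p`, of CM types of `K` with CONSTANT SUM
  `#{j | s ∈ Ψ_j} = p`: `Deligne1982.IsWeilTypeCM (⨁ B) (⊕ act_j(b₀)) R e₀ p` for the diagonal action of `b₀` ITSELF (no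
  change of generator as in `exists_isWeilTypeCM_of_constantSum`): multiplicities `= p` by
  `eigenMultiplicity_diagHom_eq_card` — Deligne §5 (c) «`a_s = Σᵢ Φᵢ(s)` … `a_s = b_s = d/2`», Milne 2020 2.2 (Weil-type half).

## References
* [Deligne1982HodgeCycles] P. Deligne (notes by J. S. Milne), LNM 900 (1982), §4 p. 30, Prop. 4.4; §5 (c) p. 38.
* [Milne2020HodgeClassesAV] J. S. Milne, arXiv:2010.08857, 2.1–2.2.
* [Andre1992HodgeCM] Y. André (1992), Théorème.
-/

noncomputable section

namespace Summit.HodgeConjecture.CorCM.AndreSplit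

open CategoryTheory CategoryTheory.Limits Polynomial NumberField
open Literature.AlgebraicGeometry Literature.AlgebraicGeometry.Motives Literature.AlgebraicGeometry.HodgeTheory
open Literature.AlgebraicGeometry.ComplexMultiplication Literature.AlgebraicGeometry.Deligne1982
open Literature.NumberTheory.Automorphic.PicardCM (eigenline)
open Summit.HodgeConjecture.CorCM.AndreProductForm Summit.HodgeConjecture.CorCM.Milne2020

/-! ## §1 A purely imaginary separating integer and Deligne's presentation `E = ℚ(b₀)`, `P = R(T²)` -/

section Arithmetic

variable (K : Type) [Field K] [NumberField K] [IsCMField K]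

/-- **A purely imaginary algebraic integer separating the complex embeddings** of a CM field `K`: from a
separating integer `a₀` (`Milne2020.exists_integer_separating`) take `b₀ = (a₀ - ā₀)(a₀ + ā₀ + t)` with `t ∈ ℕ` off the
finitely many bad values (`Deligne1982.exists_nat_candidate_injOn`); then `b̄₀ = -b₀` and `σ ↦ σ(b₀)` is injective
(Deligne's generator `η` of `E = ℚ(η)` with `η̄ = -η`, chosen integral). [cite: Deligne1982HodgeCycles, §4 p. 30] -/
theorem exists_imaginary_separating :
    ∃ b₀ : 𝓞 K, IsCMField.complexConj K (b₀ : K) = -(b₀ : K) ∧ Function.Injective fun σ : K →+* ℂ => σ (b₀ : K) := by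
  classical
  obtain ⟨a₀, hsep⟩ := exists_integer_separating K
  let Z : Finset ℂ := Finset.univ.image fun σ : K →+* ℂ => σ (a₀ : K)
  have hZ : ∀ ρ ∈ Z, starRingEnd ℂ ρ ≠ ρ := by
    intro ρ hρ hfix
    obtain ⟨σ, -, rfl⟩ := Finset.mem_image.1 hρ
    refine IsTotallyComplex.complexEmbedding_not_isReal σ (ComplexEmbedding.isReal_iff.mpr (hsep ?_))
    change ComplexEmbedding.conjugate σ (a₀ : K) = σ (a₀ : K)
    rw [ComplexEmbedding.conjugate_coe_eq]
    exact hfix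
  obtain ⟨t, -, hinj⟩ := exists_nat_candidate_injOn Z hZ (N := 1) one_ne_zero
  set ab : 𝓞 K := IsCMField.ringOfIntegersComplexConj K a₀ with hab
  have habK : (ab : K) = IsCMField.complexConj K (a₀ : K) := IsCMField.coe_ringOfIntegersComplexConj K a₀
  refine ⟨(a₀ - ab) * (a₀ + ab + t), ?_, ?_⟩
  · have e : (((a₀ - ab) * (a₀ + ab + t) : 𝓞 K) : K) = ((a₀ : K) - ab) * ((a₀ : K) + ab + t) := by
      push_cast; ring
    rw [e, map_mul, map_sub, map_add, map_add, habK, IsCMField.complexConj_apply_apply, map_natCast]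
    ring
  · intro σ σ' hσσ'
    have hval : ∀ τ : K →+* ℂ, τ ((((a₀ - ab) * (a₀ + ab + t) : 𝓞 K) : K)) =
        ((1 : ℤ) * τ (a₀ : K) - (1 : ℤ) * starRingEnd ℂ (τ (a₀ : K))) *
          ((1 : ℤ) * τ (a₀ : K) + (1 : ℤ) * starRingEnd ℂ (τ (a₀ : K)) + (t : ℂ)) := by
      intro τ
      have e : (((a₀ - ab) * (a₀ + ab + t) : 𝓞 K) : K) = ((a₀ : K) - ab) * ((a₀ : K) + ab + t) := by
        push_cast; ring
      rw [e, map_mul, map_sub, map_add, map_add, habK, IsCMField.complexEmbedding_complexConj, map_natCast]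
      simp
    have h := hinj (σ (a₀ : K)) (Finset.mem_image.2 ⟨σ, Finset.mem_univ _, rfl⟩) (σ' (a₀ : K))
      (Finset.mem_image.2 ⟨σ', Finset.mem_univ _, rfl⟩)
    have hσσ'' : σ ((((a₀ - ab) * (a₀ + ab + t) : 𝓞 K) : K)) = σ' ((((a₀ - ab) * (a₀ + ab + t) : 𝓞 K) : K)) :=
      hσσ'
    rw [hval, hval] at hσσ''
    exact hsep (h hσσ'')

variable {K}

/-- **Deligne's presentation `E = ℚ[T]/(R(T²))` for a purely imaginary separating integer.** For `K` a Galois CM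
field and `b₀ ∈ 𝓞_K` purely imaginary separating the embeddings: `minpoly_ℤ(b₀) = R(T²)` with `R ∈ ℤ[S]` monic of degree
`e₀ = [K:ℚ]/2`, `P_R = R(T²)` irreducible over `ℚ` of degree `[K:ℚ]` with root `b₀`, all roots of `R` real negative, and
`P_R` a Galois CM field polynomial (`Milne2020.isGaloisCMFieldPoly_minpoly`; evenness by `Deligne1982.exists_even_minpoly`).
[cite: Deligne1982HodgeCycles, §4 p. 30 («E = ℚ(η) … η̄ = -η … F = ℚ(η²) totally real»)] [cite: Milne2020HodgeClassesAV, §2 2.1] -/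
theorem exists_sq_eq_minpoly [IsGalois ℚ K] {b₀ : 𝓞 K} (hb₀ : IsCMField.complexConj K (b₀ : K) = -(b₀ : K))
    (hsep : Function.Injective fun σ : K →+* ℂ => σ (b₀ : K)) :
    ∃ (R : Polynomial ℤ) (e₀ : ℕ), Module.finrank ℚ K = 2 * e₀ ∧ R.Monic ∧ R.natDegree = e₀ ∧
      R.comp (X ^ 2) = minpoly ℤ b₀ ∧ Irreducible (cmPolyQ R) ∧
      (∀ s : ℂ, Polynomial.eval₂ (Int.castRingHom ℂ) s R = 0 → s.im = 0 ∧ s.re < 0) ∧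
      Polynomial.aeval (b₀ : K) (cmPolyQ R) = 0 ∧ (cmPolyQ R).natDegree = Module.finrank ℚ K ∧
      IsGaloisCMFieldPoly (R.comp (X ^ 2)) (2 * e₀) := by
  obtain ⟨hPm, hPirr, hPe, hroot, -⟩ := minpoly_facts K b₀ hsep
  have hinj : ∀ ρ ρ' : ℂ, Polynomial.eval₂ (Int.castRingHom ℂ) ρ (minpoly ℤ b₀) = 0 →
      Polynomial.eval₂ (Int.castRingHom ℂ) ρ' (minpoly ℤ b₀) = 0 →
      Polynomial.eval₂ (Int.castRingHom ℂ) ρ X = Polynomial.eval₂ (Int.castRingHom ℂ) ρ' X → ρ = ρ' := by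
    intro ρ ρ' _ _ h
    simpa only [Polynomial.eval₂_X] using h
  have hodd : ∀ ρ : ℂ, Polynomial.eval₂ (Int.castRingHom ℂ) ρ (minpoly ℤ b₀) = 0 →
      starRingEnd ℂ (Polynomial.eval₂ (Int.castRingHom ℂ) ρ X) = -Polynomial.eval₂ (Int.castRingHom ℂ) ρ X := by
    intro ρ hρ
    obtain ⟨σ, rfl⟩ := exists_embedding_of_root K b₀ hρ
    rw [Polynomial.eval₂_X, ← IsCMField.complexEmbedding_complexConj, hb₀, map_neg]
  have hnr : ∀ ρ : ℂ, Polynomial.eval₂ (Int.castRingHom ℂ) ρ (minpoly ℤ b₀) = 0 → starRingEnd ℂ ρ ≠ ρ := by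
    intro ρ hρ hfix
    obtain ⟨σ, rfl⟩ := exists_embedding_of_root K b₀ hρ
    refine IsTotallyComplex.complexEmbedding_not_isReal σ (ComplexEmbedding.isReal_iff.mpr (hsep ?_))
    change ComplexEmbedding.conjugate σ (b₀ : K) = σ (b₀ : K)
    rw [ComplexEmbedding.conjugate_coe_eq]
    exact hfix
  obtain ⟨R, e₀, he, hRm, hRdeg, hRirr, hRroots, hdvd, -⟩ := exists_even_minpoly hPm hPe hPirr hinj hodd hnr
  rw [Polynomial.comp_X] at hdvd
  have hRcm : (R.comp (X ^ 2)).Monic := hRm.comp (Polynomial.monic_X_pow 2) (by rw [Polynomial.natDegree_X_pow]; norm_num)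
  have hRcdeg : (R.comp (X ^ 2)).natDegree = 2 * e₀ := by
    rw [Polynomial.natDegree_comp, hRdeg, Polynomial.natDegree_X_pow, mul_comm]
  have heq : R.comp (X ^ 2) = minpoly ℤ b₀ :=
    Polynomial.eq_of_monic_of_dvd_of_natDegree_le hPm hRcm hdvd (by rw [hRcdeg, hPe, he])
  have hdegQ : (cmPolyQ R).natDegree = Module.finrank ℚ K := by
    rw [cmPolyQ, Polynomial.natDegree_map_eq_of_injective (Int.castRingHom ℚ).injective_int, hRcdeg, he]
  refine ⟨R, e₀, he, hRm, hRdeg, heq, hRirr, hRroots, ?_, hdegQ, ?_⟩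
  · rw [cmPolyQ, heq, minpoly_int_map_eq]
    exact minpoly.aeval ℚ (b₀ : K)
  · rw [heq, ← he]
    exact isGaloisCMFieldPoly_minpoly K b₀ hsep

end Arithmetic

/-! ## §2 Weil type of André's constant-sum products for the diagonal action of a separating integer (no generator change) -/

section WeilType

variable (K : Type) [Field K] [NumberField K]

open scoped Classical in
/-- **Weil type on Deligne's carriers for `η = act(b₀)` ITSELF** (no change of generator): for `K` a Galois CM field,
realisations `(B_j, Ψ_j)`, `j < d = 2p`, with CONSTANT SUM `#{j | s ∈ Ψ_j} = p`, and `b₀ ∈ 𝓞_K` separating the embeddings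
with `minpoly_ℤ(b₀) = R(T²)` as in `exists_sq_eq_minpoly`, the diagonal endomorphism `η = ⊕_j act_j(b₀)` of `⨁ B` satisfies
`Deligne1982.IsWeilTypeCM (⨁ B) η R e₀ p`: `R(T²)(η) = 0` (`Milne2020.eval₂_diagHom_minpoly`), `dim ⨁B = 2p·e₀`
(`AndreProductForm.two_mul_dim_biproduct`), and every multiplicity equals `p` (`eigenMultiplicity_diagHom_eq_card` and the
constant sum: Deligne's «`a_s = Σᵢ Φᵢ(s)` … `a_s = b_s = d/2`»). [cite: Deligne1982HodgeCycles, §4 Prop. 4.4 and §5 (c) p. 38]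
[cite: Milne2020HodgeClassesAV, §2 2.2 (Weil-type half)] -/
theorem isWeilTypeCM_diagHom [IsCMField K] [IsGalois ℚ K]
    {d p : ℕ} (hd : d = 2 * p) (hp : 0 < p) (B : Fin d → AbelianVariety ℂ)
    (act : ∀ j, 𝓞 K →+* End (B j)) {θB : ∀ j, K →+* Module.End ℂ (complexBetti (B j).X 1)}
    {Ψ : Fin d → CMType K} (hB : ∀ j, IsCMTypeRealisation (Ψ j) (B j) (act j) (θB j))
    (hadm : ∀ s : K →+* ℂ, (Finset.univ.filter fun j : Fin d => s ∈ (Ψ j).1).card = p)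
    (b₀ : 𝓞 K) (hsep : Function.Injective fun σ : K →+* ℂ => σ (b₀ : K))
    {R : Polynomial ℤ} {e₀ : ℕ} (he : Module.finrank ℚ K = 2 * e₀) (hRm : R.Monic) (hRdeg : R.natDegree = e₀)
    (hR : R.comp (X ^ 2) = minpoly ℤ b₀) (hirr : Irreducible (cmPolyQ R))
    (hroots : ∀ s : ℂ, Polynomial.eval₂ (Int.castRingHom ℂ) s R = 0 → s.im = 0 ∧ s.re < 0) :
    IsWeilTypeCM (⨁ B) (diagHom K B act b₀) R e₀ p := by
  subst hd
  have hv : ∀ j, ∃ v : Module.Basis (K →+* ℂ) ℂ (complexBetti (B j).X 1), ∀ σ, v σ ∈ eigenline (θB j) σ :=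
    fun j => exists_eigenbasis (hB j)
  choose vB hvB using hv
  have hfin : 0 < Module.finrank ℚ K := Module.finrank_pos
  have hdim : Module.finrank ℚ K * (2 * p) = 2 * (⨁ B).dim := by
    rw [two_mul_dim_biproduct B vB, Fintype.card_fin, ← NumberField.Embeddings.card K ℂ, mul_comm]
  refine ⟨by omega, hp, hRm, hRdeg, hirr, hroots, ?_, ?_, ?_⟩
  · rw [hR]
    exact eval₂_diagHom_minpoly K B act b₀
  · rw [he] at hdim
    have e : 2 * (⨁ B).dim = 2 * (2 * p * e₀) := by rw [← hdim]; ring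
    exact Nat.eq_of_mul_eq_mul_left two_pos e
  · intro ρ hρ
    rw [hR] at hρ
    obtain ⟨s, rfl⟩ := exists_embedding_of_root K b₀ hρ
    rw [eigenMultiplicity_diagHom_eq_card K B act hB b₀ hsep s, hadm s]

end WeilType

end Summit.HodgeConjecture.CorCM.AndreSplit

end
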